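import Literature.Analysis.FunctionSpaces.FourierSobolevNorm
import Mathlib.Analysis.InnerProductSpace.ProdL2
import Mathlib.Analysis.Normed.Lp.MeasurableSpace
import Mathlib.MeasureTheory.Function.UnifTight
import HarnessLib

/-!
# Velocity averaging lemmas (Golse–Lions–Perthame–Sentis) for the free transport operator

Topic: MathematicalPhysics / KineticTheory. Step 11 of the DiPerna–Lions global existence proof
for the Boltzmann equation (Cercignani–Illner–Pulvirenti 1994 §5.3, after Gérard): moments in the
velocity variable of solutions of the free transport equation `(∂ₜ + ξ·∇ₓ) u = h` are more
regular / more compact than `u` itself.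

* `Kinetic.transportDeriv φ z = (∂ₜ + ξ·∇ₓ) φ (t, x, ξ)` for a test function on `ℝ × E × E`;
  `Kinetic.HasDistribTransportOn S u h`: `(∂ₜ + ξ·∇ₓ) u = h` in `𝒟'(S × E × E)` (`S ⊆ ℝ` an open
  set of times; `S = univ` is the whole space-time), for locally integrable `u, h`.
* `Kinetic.velocityIntegral ψ u (t, x) = ∫ u(t, x, ξ) ψ(t, x, ξ) dξ`, the velocity average, and its
  complex-valued copy `Kinetic.velocityIntegralC` on Euclidean space-time `WithLp 2 (ℝ × E)` (the
  carrier of the tree's Fourier-side Sobolev norms `Function.eSobolevNorm`, `Literature.Analysis.FunctionSpaces.MemFourierSobolev`).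
* `Kinetic.velocityAveraging_L2` (named fact; CIP 1994 Lemma 5.3.8 = Golse–Lions–Perthame–Sentis
  1988; Lions 1993 Thm IV.1 with `p = 2, α = 1`): `u ∈ L²(ℝ × E × E)` with compact support and
  `Tu ∈ L²` ⇒ `∫ u dξ ∈ H^{1/2}(ℝ × E)`, with `H^{1/2}`-norm bounded on sets where `‖u‖₂`, `‖Tu‖₂`
  and the support are bounded.
* `Kinetic.velocityAverage_relativelyCompact_L1` (named fact; CIP 1994 Lemma 5.3.9, DiPerna–Lions
  1989): for `(gₙ)` weakly relatively compact in `L¹((0,T) × E × E)` (Dunford–Pettis form: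
  uniformly integrable and tight) with `(Tgₙ)` weakly relatively compact in `L¹_loc`, and `ψₙ`
  bounded in `L^∞` converging a.e., the velocity averages `∫ gₙ ψₙ dξ` are relatively compact in the
  norm topology of `L¹((0,T) × E)`.

## Mathlib / tree reuse

Mathlib: `fderiv`, `ContDiff`, `HasCompactSupport`, `tsupport`, `MeasureTheory.LocallyIntegrableOn`,
`MemLp`/`eLpNorm`, `UniformIntegrable`, `UnifTight`, the Euclidean product `WithLp 2 (ℝ × E)` with
its inner product (`Mathlib/Analysis/InnerProductSpace/ProdL2`) and Borel structure
(`Mathlib/Analysis/Normed/Lp/MeasurableSpace`). Tree: `Function.eSobolevNorm`,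
`Literature.Analysis.FunctionSpaces.MemFourierSobolev` (`Literature/Analysis/FunctionSpaces/FourierSobolevNorm`). Mathlib has no
velocity averaging and no kinetic transport operator (searched `averag`, `transport`, `kinetic`).
The tree's `Literature.Analysis.FluidPDE.velocityAverage` (`BoltzmannGradLimit`) is the `s`-particle observable
average of the Lanford programme, a different object; hence the name `velocityIntegral` here.

## Design

* Phase space-time points are uncurried triples `z = (t, x, ξ) : ℝ × E × E` with the product
  Lebesgue measure `volume` (positions and velocities in the same finite-dimensional inner product
  space `E`, as in `Kinetic.IsRenormalisedSolution`); curried densities `f : ℝ → E → E → ℝ` of the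
  Boltzmann files enter as `fun z => f z.1 z.2.1 z.2.2`.
* Weak relative compactness in `L¹` is written in its Dunford–Pettis form (bounded +
  equi-integrable = `UniformIntegrable _ 1`, plus `UnifTight _ 1`), exactly the criteria (ii a–c)
  that CIP verify (Lemma 5.3.7) before applying Lemma 5.3.9; relative norm-compactness of a
  sequence is written sequentially (every subsequence has an `L¹`-convergent subsequence).
* `H^{1/2}(ℝ × E)` is the tree's Fourier-side `H^s` on the Euclidean space-time
  `WithLp 2 (ℝ × E)` (inner product `tτ + ⟪x, z⟫`), applied to the complexified average.

## References

* C. Cercignani, R. Illner, M. Pulvirenti, *The Mathematical Theory of Dilute Gases* (1994),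
  §5.3, Lemma 5.3.8 (p. 153), Lemma 5.3.9 and Corollary (pp. 154–155).
* F. Golse, P.-L. Lions, B. Perthame, R. Sentis, *Regularity of the moments of the solution of a
  transport equation*, J. Funct. Anal. 76 (1988) 110–125.
* P.-L. Lions, *Global solutions of kinetic models and related problems*, in: Nonequilibrium
  Problems in Many-Particle Systems, LNM 1551 (1993), Thm IV.1 (p. 52–53), Example IV.1.
* R. DiPerna, P.-L. Lions, Ann. Math. 130 (1989) 321–366, §II.
* L. Saint-Raymond, *Hydrodynamic Limits of the Boltzmann Equation*, LNM 1971 (2009), Prop. 3.3.1.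
-/

noncomputable section

open MeasureTheory Filter Topology Set
open scoped ENNReal NNReal ContDiff

namespace Literature.MathematicalPhysics.KineticTheory

variable {E : Type*} [NormedAddCommGroup E] [InnerProductSpace ℝ E] [FiniteDimensional ℝ E]
  [MeasurableSpace E] [BorelSpace E]

/-! ## The free transport operator in the sense of distributions -/

/-- The free-transport derivative `(∂ₜ + ξ·∇ₓ) φ` of a (test) function on phase space-time,
at `z = (t, x, ξ)`: the Fréchet derivative of `φ` at `z` in the direction `(1, ξ, 0)`
(CIP 1994 §5.3 Step 1, `T = ∂ₜ + ξ·∇ₓ`). [cite: CIP1994, §5.3 Step 1] -/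
def transportDeriv (φ : ℝ × E × E → ℝ) (z : ℝ × E × E) : ℝ :=
  fderiv ℝ φ z ((1 : ℝ), z.2.2, (0 : E))

/-- `HasDistribTransportOn S u h`: on the open time set `S ⊆ ℝ`, the locally integrable functions
`u, h` on `S × E × E` satisfy `(∂ₜ + ξ·∇ₓ) u = h` in the sense of distributions
`𝒟'(S × E × E)`: for every `φ ∈ C_c^∞(ℝ × E × E)` supported in `S × E × E`,
`∫ u · (∂ₜ + ξ·∇ₓ)φ = -∫ h φ` (the vector field `(1, ξ, 0)` is divergence free)
(CIP 1994 §5.3, "`Tu ∈ L²`", "`Tgₙ` in `L¹_loc`", Lemmas 5.3.8–5.3.9; Lions 1993 (52)). [cite: CIP1994, §5.3 Lemma 5.3.8–5.3.9] -/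
def HasDistribTransportOn (S : Set ℝ) (u h : ℝ × E × E → ℝ) : Prop :=
  LocallyIntegrableOn u (S ×ˢ univ) volume ∧ LocallyIntegrableOn h (S ×ˢ univ) volume ∧
    ∀ φ : ℝ × E × E → ℝ, ContDiff ℝ ∞ φ → HasCompactSupport φ → tsupport φ ⊆ S ×ˢ univ →
      ∫ z, u z * transportDeriv φ z = -∫ z, h z * φ z

/-- Unfolding of `HasDistribTransportOn`. [folklore] -/
theorem hasDistribTransportOn_iff (S : Set ℝ) (u h : ℝ × E × E → ℝ) :
    HasDistribTransportOn S u h ↔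
      LocallyIntegrableOn u (S ×ˢ univ) volume ∧ LocallyIntegrableOn h (S ×ˢ univ) volume ∧
        ∀ φ : ℝ × E × E → ℝ, ContDiff ℝ ∞ φ → HasCompactSupport φ → tsupport φ ⊆ S ×ˢ univ →
          ∫ z, u z * transportDeriv φ z = -∫ z, h z * φ z :=
  Iff.rfl

/-- The zero function solves `T 0 = 0` in `𝒟'`. [folklore] -/
theorem hasDistribTransportOn_zero (S : Set ℝ) :
    HasDistribTransportOn S (fun _ : ℝ × E × E => (0 : ℝ)) (fun _ => 0) := by
  refine ⟨locallyIntegrableOn_zero, locallyIntegrableOn_zero, fun φ _ _ _ => ?_⟩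
  simp

/-! ## Velocity averages -/

/-- The velocity average (moment) `∫ u(t, x, ξ) ψ(t, x, ξ) dξ` of a phase-space-time function `u`
against a weight `ψ` (CIP 1994 Lemma 5.3.9: `∫ gₙ ψₙ dξ`; Lions 1993 Thm IV.1: `∫ ψ(v) g dv`).
Bochner integral in `ξ`, junk value `0`. [cite: CIP1994, §5.3 Lemma 5.3.9] -/
def velocityIntegral (ψ u : ℝ × E × E → ℝ) (p : ℝ × E) : ℝ :=
  ∫ ξ, u (p.1, p.2, ξ) * ψ (p.1, p.2, ξ)

/-- The velocity average as a complex-valued function on Euclidean space-time `WithLp 2 (ℝ × E)`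
(inner product `t τ + ⟪x, z⟫`), the carrier on which the tree's Fourier-side Sobolev norms are
defined. [folklore] -/
def velocityIntegralC (ψ u : ℝ × E × E → ℝ) (q : WithLp 2 (ℝ × E)) : ℂ :=
  (velocityIntegral ψ u (WithLp.ofLp q) : ℂ)

/-- Unfolding of `velocityIntegralC`. [folklore] -/
theorem velocityIntegralC_apply (ψ u : ℝ × E × E → ℝ) (q : WithLp 2 (ℝ × E)) :
    velocityIntegralC ψ u q = (velocityIntegral ψ u (WithLp.ofLp q) : ℂ) :=
  rfl

/-- The velocity average of the zero function vanishes. [folklore] -/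
theorem velocityIntegral_zero (ψ : ℝ × E × E → ℝ) :
    velocityIntegral ψ (fun _ => (0 : ℝ)) = fun _ => 0 := by
  funext p
  simp [velocityIntegral]

/-! ## The `L²` velocity averaging lemma (named fact) -/

/-- **Velocity averaging in `L²`** (Golse–Lions–Perthame–Sentis 1988; CIP 1994 Lemma 5.3.8,
p. 153; Lions 1993 Thm IV.1 with `p = 2`, `a(v) = v`, `α = 1`, Example IV.1). Let
`u ∈ L²(ℝ × E × E)` have compact support and satisfy `Tu = (∂ₜ + ξ·∇ₓ) u = h ∈ L²(ℝ × E × E)` in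
`𝒟'`. Then the velocity average `∫ u dξ` belongs to `H^{1/2}(ℝ × E)`, and its `H^{1/2}`-norm is
bounded in terms of `‖u‖_{L²}`, `‖Tu‖_{L²}` and the support of `u`: for every compact
`K ⊆ ℝ × E × E` and every `M`, there is `C` such that `‖∫ u dξ‖_{H^{1/2}} ≤ C` whenever `u` vanishes
off `K`, `‖u‖₂ ≤ M` and `‖Tu‖₂ ≤ M`. (`H^{1/2}` = the tree's Fourier-side Sobolev space on Euclidean
space-time, `Literature.MemFourierSobolev (1/2)` / `Function.eSobolevNorm (1/2)`, applied to the
complexified average `velocityIntegralC 1 u`.) [cite: CIP1994, §5.3 Lemma 5.3.8] -/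
def velocityAveraging_L2 : Prop :=
  ∀ {E : Type*} [NormedAddCommGroup E] [InnerProductSpace ℝ E] [FiniteDimensional ℝ E]
    [MeasurableSpace E] [BorelSpace E] (K : Set (ℝ × E × E)) (M : ℝ), IsCompact K →
    ∃ C : ℝ≥0, ∀ u h : ℝ × E × E → ℝ,
      MemLp u 2 volume → MemLp h 2 volume → (∀ z ∉ K, u z = 0) →
      HasDistribTransportOn univ u h →
      eLpNorm u 2 volume ≤ ENNReal.ofReal M → eLpNorm h 2 volume ≤ ENNReal.ofReal M →
        Literature.Analysis.FunctionSpaces.MemFourierSobolev (1 / 2 : ℝ) (velocityIntegralC (fun _ => 1) u) ∧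
          Function.eSobolevNorm (1 / 2 : ℝ) (velocityIntegralC (fun _ => 1) u) ≤ C

/-! ## `L¹` compactness of velocity averages (named fact) -/

/-- The phase-space-time slab measure: Lebesgue measure on `(0, T) × E × E`. [folklore] -/
def slabMeasure (E : Type*) [NormedAddCommGroup E] [InnerProductSpace ℝ E] [FiniteDimensional ℝ E]
    [MeasurableSpace E] [BorelSpace E] (T : ℝ) : Measure (ℝ × E × E) :=
  volume.restrict (Ioo 0 T ×ˢ univ)

/-- The space-time slab measure: Lebesgue measure on `(0, T) × E`. [folklore] -/
def baseSlabMeasure (E : Type*) [NormedAddCommGroup E] [InnerProductSpace ℝ E]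
    [FiniteDimensional ℝ E] [MeasurableSpace E] [BorelSpace E] (T : ℝ) : Measure (ℝ × E) :=
  volume.restrict (Ioo 0 T ×ˢ univ)

/-- Unfolding of `slabMeasure`. [folklore] -/
theorem slabMeasure_def (T : ℝ) : slabMeasure E T = volume.restrict (Ioo 0 T ×ˢ univ) := rfl

/-- Unfolding of `baseSlabMeasure`. [folklore] -/
theorem baseSlabMeasure_def (T : ℝ) : baseSlabMeasure E T = volume.restrict (Ioo 0 T ×ˢ univ) :=
  rfl

/-- **`L¹` compactness of velocity averages** (CIP 1994 Lemma 5.3.9, p. 154; DiPerna–Lions 1989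
§II; Golse–Lions–Perthame–Sentis 1988). Let `(gₙ) ⊆ L¹((0,T) × E × E)` be weakly relatively
compact — in Dunford–Pettis form (CIP §5.3 Step 8): bounded and equi-integrable
(`UniformIntegrable _ 1`) and uniformly tight (`UnifTight _ 1`) for Lebesgue measure on the slab —
and suppose that `Tgₙ = (∂ₜ + ξ·∇ₓ) gₙ = hₙ` in `𝒟'((0,T) × E × E)` with `(hₙ)` weakly relatively
compact in `L¹_loc((0,T) × E × E)` (uniformly integrable on every compact subset of the open slab).
Then, if `(ψₙ)` is a bounded sequence in `L^∞((0,T) × E × E)` converging a.e., the velocity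
averages `ρₙ = ∫ gₙ ψₙ dξ` form a relatively compact sequence in the norm topology of
`L¹((0,T) × E)`: every subsequence has a further subsequence converging in `L¹((0,T) × E)` to an
integrable limit. [cite: CIP1994, §5.3 Lemma 5.3.9] -/
def velocityAverage_relativelyCompact_L1 : Prop :=
  ∀ {E : Type*} [NormedAddCommGroup E] [InnerProductSpace ℝ E] [FiniteDimensional ℝ E]
    [MeasurableSpace E] [BorelSpace E] {T : ℝ} {g h ψ : ℕ → ℝ × E × E → ℝ} {ψlim : ℝ × E × E → ℝ},
    UniformIntegrable g 1 (slabMeasure E T) → UnifTight g 1 (slabMeasure E T) →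
    (∀ n, HasDistribTransportOn (Ioo 0 T) (g n) (h n)) →
    (∀ K ⊆ Ioo 0 T ×ˢ univ, IsCompact K → UniformIntegrable h 1 (volume.restrict K)) →
    (∀ n, AEStronglyMeasurable (ψ n) (slabMeasure E T)) →
    (∃ M : ℝ, ∀ n, ∀ᵐ z ∂slabMeasure E T, |ψ n z| ≤ M) →
    (∀ᵐ z ∂slabMeasure E T, Tendsto (fun n => ψ n z) atTop (𝓝 (ψlim z))) →
      ∀ φ : ℕ → ℕ, StrictMono φ → ∃ φ' : ℕ → ℕ, StrictMono φ' ∧ ∃ ρ : ℝ × E → ℝ,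
        Integrable ρ (baseSlabMeasure E T) ∧
        Tendsto (fun k => ∫ p, |velocityIntegral (ψ (φ (φ' k))) (g (φ (φ' k))) p - ρ p|
          ∂baseSlabMeasure E T) atTop (𝓝 0)

end Literature.MathematicalPhysics.KineticTheory
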